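import Summits.CriticalPhenomena.PercolationContinuityZ3.Theorems.SahiAEBandShift

/-!
# The band theorem, geometric step: open planar bands, arm boxes, and a dense generic sequence of base points

Support file of the Sahi cell (`prim-sahi`, typer seat, generation 24; `--supports stmt-CriticalPhenomena-4575`).
Two small definitions (`IsBand`, `armBox`), theorems otherwise; no named facts, no sorries.

An **open band** `B ⊆ ℝ²` (`IsBand`) is an open set closed under `∧` and `∨` whose horizontal and vertical sections
are intervals (axis-parallel segments between points of `B` stay in `B`); equivalently the open region between two
non-decreasing curves — in the measurable setting, the essential support of an a.e.-TP₂ density without null rows or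
columns (the continuous form of the double-echelon zero pattern of a `TN₂` matrix without zero lines,
Fallat–Johnson, *Totally nonnegative matrices* (2011), §1.6).  A band has no global base point and is not a nested
union of boxes; the substitute is the family of **arm boxes**

  `armBox B c = {p > c : (p₀, c₁) ∈ B, (c₀, p₁) ∈ B}`

(`c ∈ B`; the maximal open box with lower-left corner `c` inside `B`): `armBox B c ⊆ B` is an open box-like
sublattice, `[c, p ∨ q] ⊆ B` for `p, q ∈ armBox B c` (`Icc_subset_of_arms`), and — the key covering property —
for `d ≤ e` in `B` with the two mixed corners `(e₀, d₁)`, `(d₀, e₁)` in `B` (e.g. `d = x ∧ y`, `e = x ∨ y` for an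
incomparable pair of `B`, or `d ≤ e = p` with `p` in two arm boxes) the base points `c` with `[d, e] ⊆ armBox B c`
form a NON-EMPTY OPEN subset of `B` (`exists_open_base_set`).  Closed boxes inside `B` sit inside rational boxes
carrying patch functions (`exists_patch_box`, from `SahiAEBandPatch.lean`).

Finally `exists_band_seq`: a sequence of base points `c_n ∈ B` which is DENSE in `B` (meets every non-empty open
subset of `B`), every `c_n` generic and every pair `(c_m, c_n)`, `m ≠ n`, generic for every patched function
`patch φ j` (recursion over finite histories inside co-null sets; open sets have positive Lebesgue measure).

No sorries, no new axioms.
-/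

noncomputable section

namespace Summit.CriticalPhenomena.PercolationContinuityZ3.Theorems.SahiAEFourFunctions

namespace Plane

open MeasureTheory Set Filter Topology Function
open scoped ENNReal NNReal

/-! ### Open bands -/

/-- **An open planar band**: open, closed under meet and join, with order-convex horizontal and vertical sections
(axis-parallel segments between two of its points lie in it). [this work] -/
structure IsBand (B : Set (Fin 2 → ℝ)) : Prop where
  isOpen : IsOpen B
  inf_mem : ∀ x ∈ B, ∀ y ∈ B, x ⊓ y ∈ B
  sup_mem : ∀ x ∈ B, ∀ y ∈ B, x ⊔ y ∈ B
  seg_subset : ∀ x ∈ B, ∀ y ∈ B, x ≤ y → (x 0 = y 0 ∨ x 1 = y 1) → Icc x y ⊆ B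

/-- **The arm box** of a base point `c`: the points `p > c` whose projections `(p₀, c₁)` and `(c₀, p₁)` onto the axis
cross through `c` lie in `B`. [this work] -/
def armBox (B : Set (Fin 2 → ℝ)) (c : Fin 2 → ℝ) : Set (Fin 2 → ℝ) :=
  {p | (∀ i, c i < p i) ∧ update p 1 (c 1) ∈ B ∧ update p 0 (c 0) ∈ B}

/-- A point of the plane is the join of its two projections onto the axis cross through a smaller point.
[folklore] -/
theorem update_sup_update_eq {c z : Fin 2 → ℝ} (hcz : c ≤ z) : update z 1 (c 1) ⊔ update z 0 (c 0) = z := by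
  funext k
  fin_cases k
  · simp [hcz 0]
  · simp [hcz 1]

/-- **Horizontal segments**: a point between two points of `B` on the same horizontal line lies in `B`. [folklore] -/
theorem IsBand.update_zero_mem {B : Set (Fin 2 → ℝ)} (hB : IsBand B) {x y : Fin 2 → ℝ} (hx : x ∈ B) (hy : y ∈ B)
    (h1 : x 1 = y 1) {s : ℝ} (hxs : x 0 ≤ s) (hsy : s ≤ y 0) : update x 0 s ∈ B := by
  have hxy : x ≤ y := fun k => by
    fin_cases k
    · exact hxs.trans hsy
    · exact h1.le
  refine hB.seg_subset x hx y hy hxy (Or.inr h1) ⟨fun k => ?_, fun k => ?_⟩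
  · fin_cases k
    · simpa using hxs
    · simp
  · fin_cases k
    · simpa using hsy
    · simp [h1]

/-- **Vertical segments**: a point between two points of `B` on the same vertical line lies in `B`. [folklore] -/
theorem IsBand.update_one_mem {B : Set (Fin 2 → ℝ)} (hB : IsBand B) {x y : Fin 2 → ℝ} (hx : x ∈ B) (hy : y ∈ B)
    (h0 : x 0 = y 0) {t : ℝ} (hxt : x 1 ≤ t) (hty : t ≤ y 1) : update x 1 t ∈ B := by
  have hxy : x ≤ y := fun k => by
    fin_cases k
    · exact h0.le
    · exact hxt.trans hty
  refine hB.seg_subset x hx y hy hxy (Or.inl h0) ⟨fun k => ?_, fun k => ?_⟩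
  · fin_cases k
    · simp
    · simpa using hxt
  · fin_cases k
    · simp [h0]
    · simpa using hty

/-- **A box with its lower-left corner and its two arms in `B` lies in `B`.** [this work] -/
theorem IsBand.Icc_subset_of_arms {B : Set (Fin 2 → ℝ)} (hB : IsBand B) {c p : Fin 2 → ℝ} (hc : c ∈ B)
    (h1 : update p 1 (c 1) ∈ B) (h0 : update p 0 (c 0) ∈ B) : Icc c p ⊆ B := by
  intro z hz
  have hz1 : update z 1 (c 1) ∈ B := by
    have e : update z 1 (c 1) = update c 0 (z 0) := by
      funext k; fin_cases k <;> simp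
    rw [e]
    exact hB.update_zero_mem hc h1 (by simp) (hz.1 0) (by simpa using hz.2 0)
  have hz0 : update z 0 (c 0) ∈ B := by
    have e : update z 0 (c 0) = update c 1 (z 1) := by
      funext k; fin_cases k <;> simp
    rw [e]
    exact hB.update_one_mem hc h0 (by simp) (hz.1 1) (by simpa using hz.2 1)
  rw [← update_sup_update_eq hz.1]
  exact hB.sup_mem _ hz1 _ hz0

/-! ### Arm boxes -/

/-- Membership in an arm box. [folklore] -/
theorem mem_armBox {B : Set (Fin 2 → ℝ)} {c p : Fin 2 → ℝ} :
    p ∈ armBox B c ↔ (∀ i, c i < p i) ∧ update p 1 (c 1) ∈ B ∧ update p 0 (c 0) ∈ B := Iff.rfl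

/-- **An arm box spans boxes inside `B`**: `[c, p] ⊆ B` for `p ∈ armBox B c`. [this work] -/
theorem IsBand.Icc_subset_of_mem_armBox {B : Set (Fin 2 → ℝ)} (hB : IsBand B) {c p : Fin 2 → ℝ} (hc : c ∈ B)
    (hp : p ∈ armBox B c) : Icc c p ⊆ B :=
  hB.Icc_subset_of_arms hc hp.2.1 hp.2.2

/-- An arm box lies in `B`. [folklore] -/
theorem IsBand.armBox_subset {B : Set (Fin 2 → ℝ)} (hB : IsBand B) {c : Fin 2 → ℝ} (hc : c ∈ B) : armBox B c ⊆ B :=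
  fun _ hp => hB.Icc_subset_of_mem_armBox hc hp ⟨fun i => (hp.1 i).le, le_rfl⟩

/-- Arm boxes are closed under join. [folklore] -/
theorem sup_mem_armBox {B : Set (Fin 2 → ℝ)} {c p q : Fin 2 → ℝ} (hp : p ∈ armBox B c) (hq : q ∈ armBox B c) :
    p ⊔ q ∈ armBox B c := by
  refine ⟨fun i => (hp.1 i).trans_le (le_sup_left (a := p) (b := q) i), ?_, ?_⟩
  · rcases le_total (p 0) (q 0) with h | h
    · have e : update (p ⊔ q) 1 (c 1) = update q 1 (c 1) := by
        funext k; fin_cases k <;> simp [h]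
      rw [e]; exact hq.2.1
    · have e : update (p ⊔ q) 1 (c 1) = update p 1 (c 1) := by
        funext k; fin_cases k <;> simp [h]
      rw [e]; exact hp.2.1
  · rcases le_total (p 1) (q 1) with h | h
    · have e : update (p ⊔ q) 0 (c 0) = update q 0 (c 0) := by
        funext k; fin_cases k <;> simp [h]
      rw [e]; exact hq.2.2
    · have e : update (p ⊔ q) 0 (c 0) = update p 0 (c 0) := by
        funext k; fin_cases k <;> simp [h]
      rw [e]; exact hp.2.2

/-- Strict lower orthants are open. [folklore] -/
theorem isOpen_setOf_forall_lt (d : Fin 2 → ℝ) : IsOpen {c : Fin 2 → ℝ | ∀ i, c i < d i} := by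
  rw [Set.setOf_forall]
  exact isOpen_iInter_of_finite fun i => isOpen_lt (continuous_apply i) continuous_const

/-- Strict upper orthants are open. [folklore] -/
theorem isOpen_setOf_forall_gt (c : Fin 2 → ℝ) : IsOpen {p : Fin 2 → ℝ | ∀ i, c i < p i} := by
  rw [Set.setOf_forall]
  exact isOpen_iInter_of_finite fun i => isOpen_lt continuous_const (continuous_apply i)

/-- The arm-box conditions are open in the base point. [folklore] -/
theorem isOpen_armSet {B : Set (Fin 2 → ℝ)} (hB : IsOpen B) (d e : Fin 2 → ℝ) :
    IsOpen {c : Fin 2 → ℝ | (∀ i, c i < d i) ∧ update e 1 (c 1) ∈ B ∧ update e 0 (c 0) ∈ B} := by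
  have e1 : {c : Fin 2 → ℝ | (∀ i, c i < d i) ∧ update e 1 (c 1) ∈ B ∧ update e 0 (c 0) ∈ B} =
      {c | ∀ i, c i < d i} ∩ ((fun c : Fin 2 → ℝ => update e 1 (c 1)) ⁻¹' B ∩
        (fun c : Fin 2 → ℝ => update e 0 (c 0)) ⁻¹' B) := rfl
  rw [e1]
  exact (isOpen_setOf_forall_lt d).inter ((hB.preimage (continuous_const.update 1 (continuous_apply 1))).inter
    (hB.preimage (continuous_const.update 0 (continuous_apply 0))))

/-- Arm boxes are open. [folklore] -/
theorem isOpen_armBox {B : Set (Fin 2 → ℝ)} (hB : IsOpen B) (c : Fin 2 → ℝ) : IsOpen (armBox B c) := by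
  have e1 : armBox B c = {p | ∀ i, c i < p i} ∩ ((fun p : Fin 2 → ℝ => update p 1 (c 1)) ⁻¹' B ∩
      (fun p : Fin 2 → ℝ => update p 0 (c 0)) ⁻¹' B) := rfl
  rw [e1]
  exact (isOpen_setOf_forall_gt c).inter ((hB.preimage (continuous_id.update 1 continuous_const)).inter
    (hB.preimage (continuous_id.update 0 continuous_const)))

/-- Arm boxes are measurable. [folklore] -/
theorem measurableSet_armBox {B : Set (Fin 2 → ℝ)} (hB : IsOpen B) (c : Fin 2 → ℝ) : MeasurableSet (armBox B c) :=
  (isOpen_armBox hB c).measurableSet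

/-- **The covering property of arm boxes.**  Let `d ∈ B` and `e` be such that the two mixed corners `(e₀, d₁)`,
`(d₀, e₁)` lie in `B` (of interest for `d ≤ e`).  Then the base points `c ∈ B`, `c < d`, whose arm box contains the whole box `[d, e]` include a
NON-EMPTY OPEN subset of `B`. [this work] -/
theorem IsBand.exists_open_base_set {B : Set (Fin 2 → ℝ)} (hB : IsBand B) {d e : Fin 2 → ℝ} (hd : d ∈ B)
    (h1 : update e 1 (d 1) ∈ B) (h0 : update e 0 (d 0) ∈ B) :
    ∃ O : Set (Fin 2 → ℝ), IsOpen O ∧ O.Nonempty ∧ O ⊆ B ∧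
      ∀ c ∈ O, (∀ i, c i < d i) ∧ ∀ z ∈ Icc d e, z ∈ armBox B c := by
  set O : Set (Fin 2 → ℝ) := B ∩ {c | (∀ i, c i < d i) ∧ update e 1 (c 1) ∈ B ∧ update e 0 (c 0) ∈ B} with hO
  have hOo : IsOpen O := hB.isOpen.inter (isOpen_armSet hB.isOpen d e)
  -- non-emptiness: points slightly below-left of `d`
  have hne : O.Nonempty := by
    obtain ⟨δ, hδ, hδB⟩ := Metric.isOpen_iff.1 hB.isOpen d hd
    obtain ⟨δ₁, hδ₁, hδ₁B⟩ := Metric.isOpen_iff.1 hB.isOpen _ h1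
    obtain ⟨δ₀, hδ₀, hδ₀B⟩ := Metric.isOpen_iff.1 hB.isOpen _ h0
    set ε : ℝ := min δ (min δ₁ δ₀) / 2 with hε
    have hεpos : 0 < ε := by rw [hε]; positivity
    have hεδ : ε < δ := by
      rw [hε]; have := min_le_left δ (min δ₁ δ₀); linarith
    have hεδ₁ : ε < δ₁ := by
      rw [hε]; have := (min_le_right δ (min δ₁ δ₀)).trans (min_le_left δ₁ δ₀); linarith
    have hεδ₀ : ε < δ₀ := by
      rw [hε]; have := (min_le_right δ (min δ₁ δ₀)).trans (min_le_right δ₁ δ₀); linarith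
    set c : Fin 2 → ℝ := fun i => d i - ε with hc
    have hdist : ∀ (x y : Fin 2 → ℝ) (r : ℝ), 0 < r → (∀ i, |x i - y i| < r) → x ∈ Metric.ball y r :=
      fun x y r hr h => by
        rw [Metric.mem_ball, dist_pi_lt_iff hr]
        exact fun i => by rw [Real.dist_eq]; exact h i
    refine ⟨c, hδB (hdist c d δ hδ fun i => ?_), fun i => ?_, hδ₁B (hdist _ _ δ₁ hδ₁ fun i => ?_),
      hδ₀B (hdist _ _ δ₀ hδ₀ fun i => ?_)⟩
    · simp only [hc, sub_sub_cancel_left, abs_neg, abs_of_pos hεpos]; exact hεδ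
    · simp only [hc]; linarith
    · fin_cases i
      · simp [hδ₁]
      · simp only [Fin.mk_one, Fin.isValue, hc, update_self, sub_sub_cancel_left, abs_neg, abs_of_pos hεpos]; exact hεδ₁
    · fin_cases i
      · simp only [Fin.zero_eta, Fin.isValue, hc, update_self, sub_sub_cancel_left, abs_neg, abs_of_pos hεpos]; exact hεδ₀
      · simp [hδ₀]
  refine ⟨O, hOo, hne, Set.inter_subset_left, fun c hc => ⟨hc.2.1, fun z hz => ?_⟩⟩
  have hcB : c ∈ B := hc.1
  have hcd : ∀ i, c i < d i := hc.2.1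
  refine ⟨fun i => (hcd i).trans_le (hz.1 i), ?_, ?_⟩
  · -- `(z₀, c₁)` lies on the horizontal segment from `c` to `(e₀, c₁)`
    have e1 : update z 1 (c 1) = update c 0 (z 0) := by
      funext k; fin_cases k <;> simp
    rw [e1]
    exact hB.update_zero_mem hcB hc.2.2.1 (by simp) ((hcd 0).le.trans (hz.1 0)) (by simpa using hz.2 0)
  · have e0 : update z 0 (c 0) = update c 1 (z 1) := by
      funext k; fin_cases k <;> simp
    rw [e0]
    exact hB.update_one_mem hcB hc.2.2.2 (by simp) ((hcd 1).le.trans (hz.1 1)) (by simpa using hz.2 1)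

/-- The mixed corners of an incomparable pair are the pair itself (first case). [folklore] -/
theorem update_sup_inf_of_le_of_ge {x y : Fin 2 → ℝ} (h0 : x 0 ≤ y 0) (h1 : y 1 ≤ x 1) :
    update (x ⊔ y) 1 ((x ⊓ y) 1) = y ∧ update (x ⊔ y) 0 ((x ⊓ y) 0) = x := by
  constructor
  · funext k; fin_cases k <;> simp [h0, h1]
  · funext k; fin_cases k <;> simp [h0, h1]

/-! ### Rational boxes with patch functions -/

/-- **Closed boxes inside a band sit inside rational boxes carrying patch functions.** [this work] -/
theorem IsBand.exists_patch_box {B : Set (Fin 2 → ℝ)} (hB : IsBand B) {φ : (Fin 2 → ℝ) → ℝ} (hφ : Measurable φ)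
    (hsmB : ∀ᵐ p ∂(volume : Measure (Fin 2 → ℝ)).prod volume,
      p.1 ∈ B → p.2 ∈ B → φ p.1 + φ p.2 ≤ φ (p.1 ⊓ p.2) + φ (p.1 ⊔ p.2))
    {a b : Fin 2 → ℝ} (hab : a ≤ b) (h : Icc a b ⊆ B) :
    ∃ j : (Fin 2 → ℚ) × (Fin 2 → ℚ), (∃ g, IsPatchFn φ j g) ∧ (∀ i, ratLo j i < a i) ∧ (∀ i, b i < ratHi j i) := by
  obtain ⟨j, hlo, hhi, hjB⟩ := exists_rat_box_between hB.isOpen hab h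
  exact ⟨j, exists_isPatchFn hB.isOpen hφ hsmB (fun i => (hlo i).trans_le ((hab i).trans (hhi i).le)) hjB, hlo, hhi⟩

/-- Boxes between the corners of a strictly larger rational box. [folklore] -/
theorem Icc_subset_ratBox {j : (Fin 2 → ℚ) × (Fin 2 → ℚ)} {a b x y : Fin 2 → ℝ} (hlo : ∀ i, ratLo j i < a i)
    (hhi : ∀ i, b i < ratHi j i) (hx : a ≤ x) (hy : y ≤ b) : Icc x y ⊆ Icc (ratLo j) (ratHi j) := fun _ hz =>
  ⟨fun i => (hlo i).le.trans ((hx i).trans (hz.1 i)), fun i => ((hz.2 i).trans (hy i)).trans (hhi i).le⟩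

/-! ### A dense generic sequence of base points -/

/-- A co-null property holds somewhere in any non-empty open set. [folklore] -/
theorem exists_of_ae_of_isOpen {Q : (Fin 2 → ℝ) → Prop} (hQ : ∀ᵐ c ∂(volume : Measure (Fin 2 → ℝ)), Q c)
    {O : Set (Fin 2 → ℝ)} (hO : IsOpen O) (hne : O.Nonempty) : ∃ c ∈ O, Q c := by
  by_contra hcon
  push Not at hcon
  have h0 : volume O = 0 := measure_mono_null (fun c hc hq => hcon c hc hq) (ae_iff.1 hQ)
  exact (hO.measure_pos volume hne).ne' h0

/-- **A dense generic sequence of base points.**  For a non-empty open band `B` and a measurable `φ` there are base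
points `c_n ∈ B`, dense in `B` (every non-empty open subset of `B` contains some `c_n`), each generic and each pair
`(c_m, c_n)`, `m ≠ n`, generic for every patched function `patch φ j`. [this work] -/
theorem exists_band_seq {B : Set (Fin 2 → ℝ)} (hBo : IsOpen B) (hne : B.Nonempty) {φ : (Fin 2 → ℝ) → ℝ}
    (hφ : Measurable φ) :
    ∃ c : ℕ → Fin 2 → ℝ, (∀ n, c n ∈ B) ∧
      (∀ O : Set (Fin 2 → ℝ), IsOpen O → O.Nonempty → O ⊆ B → ∃ n, c n ∈ O) ∧
      (∀ n j, GenAt (patch φ j) (c n)) ∧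
      (∀ m n j, m ≠ n → PairGenAt (patch φ j) (c m) (c n)) := by
  classical
  obtain ⟨e, he⟩ := exists_surjective_nat ((Fin 2 → ℚ) × (Fin 2 → ℚ))
  -- the target open sets: the `k`-th rational open box if it is a non-empty subset of `B`, else `B`
  set R : ℕ → Set (Fin 2 → ℝ) := fun k => Set.pi univ fun i => Ioo (ratLo (e k) i) (ratHi (e k) i) with hR
  set T : ℕ → Set (Fin 2 → ℝ) := fun k => if R k ⊆ B ∧ (R k).Nonempty then R k else B with hT
  have hTo : ∀ k, IsOpen (T k) := fun k => by
    simp only [hT]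
    split_ifs
    · exact isOpen_set_pi Set.finite_univ fun _ _ => isOpen_Ioo
    · exact hBo
  have hTne : ∀ k, (T k).Nonempty := fun k => by
    simp only [hT]
    split_ifs with h
    · exact h.2
    · exact hne
  have hTB : ∀ k, T k ⊆ B := fun k => by
    simp only [hT]
    split_ifs with h
    · exact h.1
    · exact Subset.rfl
  -- the co-null set of good base points
  set P : (Fin 2 → ℝ) → Prop := fun c => (∀ j, GenAt (patch φ j) c) ∧
    ∀ j, ∀ᵐ c' ∂(volume : Measure (Fin 2 → ℝ)), PairGenAt (patch φ j) c c' with hP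
  have hPae : ∀ᵐ c ∂(volume : Measure (Fin 2 → ℝ)), P c := (ae_genAt_patch hφ).and (ae_pairGenAt_patch hφ)
  -- one step: a good point in `T k`, generic with a finite history of good points
  have step : ∀ (k : ℕ) (l : List (Fin 2 → ℝ)), (∀ c' ∈ l, P c') →
      ∃ c, c ∈ T k ∧ P c ∧ ∀ c' ∈ l, ∀ j, PairGenAt (patch φ j) c' c := by
    intro k l hl
    have hl' : ∀ᵐ c ∂(volume : Measure (Fin 2 → ℝ)), ∀ c' ∈ l, ∀ j, PairGenAt (patch φ j) c' c := by
      have hfin : ∀ c' ∈ l, ∀ᵐ c ∂(volume : Measure (Fin 2 → ℝ)), ∀ j, PairGenAt (patch φ j) c' c :=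
        fun c' hc' => ae_all_iff.2 fun j => (hl c' hc').2 j
      exact (ae_ball_iff l.finite_toSet.countable).2 hfin
    obtain ⟨c, hcT, hc⟩ := exists_of_ae_of_isOpen (hPae.and hl') (hTo k) (hTne k)
    exact ⟨c, hcT, hc.1, hc.2⟩
  choose! nxt hnxt using step
  -- histories
  set hist : ℕ → List (Fin 2 → ℝ) := fun k => Nat.rec [] (fun k l => l ++ [nxt k l]) k with hhist
  have hist_zero : hist 0 = [] := rfl
  have hist_succ : ∀ k, hist (k + 1) = hist k ++ [nxt k (hist k)] := fun k => rfl
  have hist_P : ∀ k, ∀ c' ∈ hist k, P c' := by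
    intro k
    induction k with
    | zero => simp [hist_zero]
    | succ k ih =>
      intro c' hc'
      rw [hist_succ, List.mem_append, List.mem_singleton] at hc'
      rcases hc' with h | h
      · exact ih c' h
      · rw [h]; exact (hnxt k (hist k) ih).2.1
  set c : ℕ → Fin 2 → ℝ := fun k => nxt k (hist k) with hc
  have hmem_hist : ∀ {m k : ℕ}, m < k → c m ∈ hist k := by
    intro m k hmk
    induction k with
    | zero => exact absurd hmk (Nat.not_lt_zero m)
    | succ k ih =>
      rw [hist_succ, List.mem_append, List.mem_singleton]
      rcases Nat.lt_succ_iff_lt_or_eq.1 hmk with h | h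
      · exact Or.inl (ih h)
      · exact Or.inr (by rw [h])
  have hcP : ∀ k, P (c k) := fun k => (hnxt k (hist k) (hist_P k)).2.1
  have hcT : ∀ k, c k ∈ T k := fun k => (hnxt k (hist k) (hist_P k)).1
  have hpair : ∀ {m k : ℕ}, m < k → ∀ j, PairGenAt (patch φ j) (c m) (c k) := fun {m k} hmk j =>
    (hnxt k (hist k) (hist_P k)).2.2 (c m) (hmem_hist hmk) j
  refine ⟨c, fun k => hTB k (hcT k), fun O hO hOne hOB => ?_, fun n j => (hcP n).1 j, fun m n j hmn => ?_⟩
  · -- density: `O` contains a non-empty rational open box, which is some `R k ⊆ B`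
    obtain ⟨x, hx⟩ := hOne
    obtain ⟨j, hlo, hhi, hj⟩ := exists_rat_box_between hO le_rfl (by simpa using hx)
    obtain ⟨k, hk⟩ := he j
    have hRk : R k ⊆ O := fun y hy => hj ⟨fun i => by
      have := (Set.mem_univ_pi.1 hy i).1; rw [hk] at this; exact this.le, fun i => by
      have := (Set.mem_univ_pi.1 hy i).2; rw [hk] at this; exact this.le⟩
    have hRne : (R k).Nonempty := ⟨x, Set.mem_univ_pi.2 fun i => by rw [hk]; exact ⟨hlo i, hhi i⟩⟩
    have hTk : T k = R k := by simp only [hT, if_pos (And.intro (hRk.trans hOB) hRne)]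
    exact ⟨k, hRk (by rw [← hTk]; exact hcT k)⟩
  · rcases Nat.lt_or_gt_of_ne hmn with h | h
    · exact hpair h j
    · exact (hpair h j).symm

end Plane

end Summit.CriticalPhenomena.PercolationContinuityZ3.Theorems.SahiAEFourFunctions
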